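import Mathlib

/-!
# Manin–Gamma cell (pub-manin-gamma0): uniqueness of multiplicative coefficient sequences (seat p1, gen 2) — SM1(b)

`proofs/T1_lead.md` §0.4 (SM1)(b): the newform `f` of level `N` (datum) and the newform `g` of level `N_E` given by
Modularity have `a_p(f) = a_p(g)` for every prime `p`, `a₁ = 1`, both coefficient sequences are multiplicative, and
both satisfy the SAME prime-power recursions `a_{p^{r+2}} = a_p a_{p^{r+1}} − χ(p) a_{p^r}` (with `χ(p) = 𝟙[p ∤ N]·p =
𝟙[p ∤ N_E]·p`, the prime supports of `N`, `N_E` being equal by (SM1)(a)). CONCLUSION: `a_n(f) = a_n(g)` for all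
`n ≥ 1`, hence `f = g`. This file machine-checks that elementary uniqueness statement for sequences with values in
any commutative ring.

* `ManinGamma.MultiplicativeUniqueness.primePow_eq` — agreement on all prime powers from agreement at `p` and the recursion.
* `ManinGamma.MultiplicativeUniqueness.eq_of_multiplicative` — agreement at every `n ≠ 0`.
Only Mathlib is imported; no `sorry`.
-/

namespace ManinGamma.MultiplicativeUniqueness

variable {R : Type*} [CommRing R]

/-- Two sequences satisfying the same second-order recursion on powers of a prime `p`, agreeing at `p⁰ = 1`
and at `p¹`, agree at every `p^r`. -/
theorem primePow_eq (a b : ℕ → R) (χ : ℕ → R) (p : ℕ)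
    (h1 : a 1 = b 1) (hp : a p = b p)
    (ra : ∀ r : ℕ, a (p ^ (r + 2)) = a p * a (p ^ (r + 1)) - χ p * a (p ^ r))
    (rb : ∀ r : ℕ, b (p ^ (r + 2)) = b p * b (p ^ (r + 1)) - χ p * b (p ^ r)) :
    ∀ r : ℕ, a (p ^ r) = b (p ^ r) := by
  -- strong two-step induction
  have key : ∀ r : ℕ, a (p ^ r) = b (p ^ r) ∧ a (p ^ (r + 1)) = b (p ^ (r + 1)) := by
    intro r
    induction r with
    | zero => exact ⟨by simpa using h1, by simpa using hp⟩
    | succ r ih =>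
      refine ⟨ih.2, ?_⟩
      rw [show r + 1 + 1 = r + 2 from rfl, ra r, rb r, hp, ih.1, ih.2]
  exact fun r => (key r).1

/-- **SM1(b).** Let `a, b : ℕ → R` be multiplicative (`a (m n) = a m · a n` for coprime `m, n`), with `a 1 = b 1 = 1`,
`a p = b p` for every prime `p`, and the same prime-power recursion `x (p^{r+2}) = x p · x (p^{r+1}) − χ p · x (p^r)`
for every prime `p`. Then `a n = b n` for every `n ≠ 0`. -/
theorem eq_of_multiplicative (a b : ℕ → R) (χ : ℕ → R)
    (ha1 : a 1 = 1) (hb1 : b 1 = 1)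
    (hma : ∀ m n : ℕ, Nat.Coprime m n → a (m * n) = a m * a n)
    (hmb : ∀ m n : ℕ, Nat.Coprime m n → b (m * n) = b m * b n)
    (hp : ∀ p : ℕ, p.Prime → a p = b p)
    (ra : ∀ p : ℕ, p.Prime → ∀ r : ℕ, a (p ^ (r + 2)) = a p * a (p ^ (r + 1)) - χ p * a (p ^ r))
    (rb : ∀ p : ℕ, p.Prime → ∀ r : ℕ, b (p ^ (r + 2)) = b p * b (p ^ (r + 1)) - χ p * b (p ^ r)) :
    ∀ n : ℕ, n ≠ 0 → a n = b n := by
  intro n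
  induction n using Nat.recOnPosPrimePosCoprime with
  | prime_pow p k hpk _ =>
    intro _
    exact primePow_eq a b χ p (by rw [ha1, hb1]) (hp p hpk) (ra p hpk) (rb p hpk) k
  | zero => intro h; exact absurd rfl h
  | one => intro _; rw [ha1, hb1]
  | coprime m n hm hn hmn ihm ihn =>
    intro _
    rw [hma m n hmn, hmb m n hmn, ihm (by omega), ihn (by omega)]

/-- The instance of SM1(b): with `χ p = if p ∣ N then 0 else p` on both sides (equal prime supports of `N` and
`N_E` make the two recursions literally the same `χ`), the coefficient sequences coincide. Stated for emphasis; it is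
`eq_of_multiplicative` verbatim. -/
theorem newform_coeffs_eq (N : ℕ) (a b : ℕ → ℤ)
    (ha1 : a 1 = 1) (hb1 : b 1 = 1)
    (hma : ∀ m n : ℕ, Nat.Coprime m n → a (m * n) = a m * a n)
    (hmb : ∀ m n : ℕ, Nat.Coprime m n → b (m * n) = b m * b n)
    (hp : ∀ p : ℕ, p.Prime → a p = b p)
    (ra : ∀ p : ℕ, p.Prime → ∀ r : ℕ,
      a (p ^ (r + 2)) = a p * a (p ^ (r + 1)) - (if p ∣ N then 0 else (p : ℤ)) * a (p ^ r))
    (rb : ∀ p : ℕ, p.Prime → ∀ r : ℕ,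
      b (p ^ (r + 2)) = b p * b (p ^ (r + 1)) - (if p ∣ N then 0 else (p : ℤ)) * b (p ^ r)) :
    ∀ n : ℕ, n ≠ 0 → a n = b n :=
  eq_of_multiplicative a b (fun p => if p ∣ N then 0 else (p : ℤ)) ha1 hb1 hma hmb hp ra rb

end ManinGamma.MultiplicativeUniqueness
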